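import Summits.BirchSwinnertonDyer.BirchSwinnertonDyer.Theorems.KimAtThreeDeepLowerOffStratumLevelLoweringRibetRows
import Summits.BirchSwinnertonDyer.BirchSwinnertonDyer.Theorems.KimAtThreeDeepLowerOffStratumLevelLoweringNonEisensteinPrime
import HarnessLib

/-!
# Route `KimAtThreeKolyvagin` (rung W2), crux `DeepLowerAtThreeOffKatoStratum` (item 19679), registered
# stub `stub_nonAdditive`, ROAD (b) CLOSED ON ITS SEMISTABLE DEPTH-`1` ROWS (`q ≢ 1 (mod 3)`): the rows from
# TEN NAMED FACTS and the row conditions ONLY — no displayed newform, root, Condition 1, period, cycle or numeral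

Cell `bsd-addord`, seat `bsd-addord-w2-acc2` (PROGRAMME PART 1b, ACCEL-LIST row (2)), gen 5; item
`stmt-BirchSwinnertonDyer-19679` (OWNER w2-c2 assembles; `--supports`, closes nothing). `…LevelLoweringRibetRows`
left ONE displayed numeral (a prime `r₀ ≡ 1 (mod Mq)` with `3 ∤ a_{r₀}(E) − r₀ − 1`);
`…LevelLoweringNonEisensteinPrime.exists_prime_one_mod_not_dvd_frobeniusTrace_sub` produces it from the
surjectivity of `ρ̄_{E,3}` (first layer of the tower hypothesis) by Chebotarev. Composition:

★★ `stub_nonAdditive_semistable_depthOne_of_mod_three_ne_one` — the registered stub's binders VERBATIM (level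
written `M·q`) + `Semistable W₀` + «ordinary if good at 3» + `v₃(∏ c_ℓ) ≤ 1` + the Tamagawa-`3` prime `q`: split
multiplicative, `q ≠ 3`, `q ∤ M`, `M` squarefree, `3 ∣ ord_q Δ`, `3 ∤ ord_ℓ Δ` at the primes `ℓ ∣ M`, `ℓ ≠ 3`,
`3 ∣ M → 3 ∤ ord_3 Δ` (i.e. `ρ̄_{E,3}` unramified exactly at `q` among the bad primes, and not finite at `3`),
`q % 3 ≠ 1` ⟹ the LOWER deep inequality of 19679, from the TEN NAMED FACTS
`ribet1990_levelLowering_gamma0_newform_at_three`, `vatsal1999_plusSymbol_congruence`,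
`greenbergVatsal2000_plusSymbol_congruence`, `ribet1984_iharaLemma`, `Skinner2016.thmC_padicValRat_bsd_rank_zero`,
`hasEntireLFunction_rat`, `rank_eq_analyticRank_of_analyticRank_le_one`, `mazur_not_dvd_maninConstant_of_odd`,
`exists_isNewformOf`, `diamond1995_refinedSerre` (all PUBLISHED; no `_OPEN`, no PRE binder).
★★′ `stub_nonAdditive_semistable_depthOne_of_ne` — the same for every `q ≠ 3` GIVEN the decision `α ≠ β` for the
level-`M` newforms congruent to `E` (Coleman–Edixhoven 1998 Thm. 2.1; the sequel file states it as a cited fact).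

What these rows ARE (numbers, not adjectives): tower-surjective `E/ℚ` of analytic rank `0`, semistable, with
exactly one factor `3` in `∏ c_ℓ` coming from a SPLIT multiplicative prime `q` (`c_q = ord_q Δ ≡ 0 mod 3`) and
`3 ∤ ord_ℓ Δ` at every other bad prime. What they are NOT: non-split Tamagawa-`3` primes (`c_ℓ = 2`, depth `0`
there), additive conductors (the (R1) fact is semistable-only), depth `≥ 2`, the corners (L_ss)/(L_m).
Theorems only; nothing booked; BSD is not proved by any of this.
-/

set_option autoImplicit false
-- the Theorems namespace of a single-conjunct summit repeats the summit name by design (D-0017)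
set_option linter.dupNamespace false

noncomputable section

open scoped MatrixGroups ModularForm Classical NNReal

open CongruenceSubgroup WeierstrassCurve Literature.NumberTheory.EllipticCurves
  Literature.NumberTheory.EllipticCurves.ModularForms

namespace Summit.BirchSwinnertonDyer.BirchSwinnertonDyer.Theorems.KimAtThreeDeepLowerOffStratumLevelLoweringRibetRowsFinal

open Summit.BirchSwinnertonDyer.BirchSwinnertonDyer.Theorems.KimAtThreeDeepLowerOffStratumLevelLoweringConditionOne
open Summit.BirchSwinnertonDyer.BirchSwinnertonDyer.Theorems.KimAtThreeDeepLowerOffStratumLevelLoweringRibetRows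
open Summit.BirchSwinnertonDyer.BirchSwinnertonDyer.Theorems.KimAtThreeDeepLowerOffStratumLevelLoweringNonEisensteinPrime
open Literature.NumberTheory.EllipticCurves.Rank1Residual Literature.NumberTheory.EllipticCurves.Rank1Residual.Typed
  Literature.NumberTheory.EllipticCurves.Skinner2016 Literature.NumberTheory.Automorphic

/-- ★★′ **The semistable depth-`1` rows of `stub_nonAdditive` from TEN NAMED FACTS, the row conditions and a
decision `α ≠ β`** (no displayed `g`, `β`, Condition 1, `Ω`, `γ₀`, `r₀`): the numeral of
`stub_nonAdditive_semistable_of_ribet_of_ne` is supplied by `exists_prime_one_mod_not_dvd_frobeniusTrace_sub`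
(Chebotarev at a commutator acting as `−1` on `E[3]`). [cite: Ribet1990, Thm. 1.1]
[cite: Diamond1995RefinedSerre, Thm. 6.4 and Cor. 6.5] [cite: Vatsal1999, §1 (1.6), Thm. (1.13)]
[cite: GreenbergVatsal2000, §3 (17)–(19)] [cite: Ribet1984ICM, Thm. 4.1] [cite: TateGCFT1967, §2.4 (Tchebotarev density theorem) with Prop. 2.3]
[cite: Skinner2016PacificMC, Thm. C (§1)] [cite: Mazur1978, Cor. 4.1] [cite: Kim2022StructureSelmer, Conj. 1.10 (PDF p. 8)] -/
theorem stub_nonAdditive_semistable_depthOne_of_ne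
    (hR : ribet1990_levelLowering_gamma0_newform_at_three)
    (hV : vatsal1999_plusSymbol_congruence) (hGV : greenbergVatsal2000_plusSymbol_congruence)
    (hI : ribet1984_iharaLemma)
    (hSk : Skinner2016.thmC_padicValRat_bsd_rank_zero)
    (hmod : hasEntireLFunction_rat) (hGZK : rank_eq_analyticRank_of_analyticRank_le_one)
    (hM : mazur_not_dvd_maninConstant_of_odd)
    (hBCDT : exists_isNewformOf) (hLL' : diamond1995_refinedSerre)
    (W₀ : WeierstrassCurve ℚ) [W₀.IsElliptic] [W₀.IsGloballyMinimal]
    (htower : ∀ n : ℕ, W₀.HasSurjectiveModNGaloisRep (3 ^ n : ℕ)) (hfin : Finite W₀.sha)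
    {M q : ℕ} [NeZero M] [NeZero q] [Fact q.Prime] [NeZero (M * q)] (hN : M * q = W₀.conductorNorm ℤ)
    (D₀ : ModularParametrizationData W₀ (M * q))
    (hopt : ∀ z ∈ D₀.L.lattice, ∃ w ∈ periodLattice D₀.f, z = D₀.c * w)
    (hdeg : ∀ (W₂ : WeierstrassCurve ℚ) [W₂.IsElliptic] (D₂ : ModularParametrizationData W₂ (M * q)),
      D₂.f = D₀.f → D₀.modularDegree ≤ D₂.modularDegree)
    (hint : ∀ r : ℚ, ratPlusSymbol D₀.f r ≠ 0 → 0 ≤ padicValRat 3 (ratPlusSymbol D₀.f r))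
    (hord : kuriharaVanishingOrder W₀ 3 D₀.f = 0)
    (hnA : ¬ (haveI : Fact (Nat.Prime 3) := ⟨Nat.prime_three⟩; Addv W₀ 3))
    (hsst : Semistable W₀) (hordinary : W₀.HasGoodReductionAtPrime 3 → ¬ (3 : ℤ) ∣ W₀.frobeniusTrace 3)
    (hv : padicValNat 3 W₀.tamagawaProduct ≤ 1)
    (hsplit : W₀.HasSplitMultiplicativeReductionAtPrime q)
    (hq3 : q ≠ 3) (hqM : ¬ q ∣ M) (hMsq : Squarefree M) (hqΔ : (3 : ℤ) ∣ padicValRat q W₀.Δ)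
    (hℓΔ : ∀ ℓ : ℕ, ℓ.Prime → ℓ ∣ M → ℓ ≠ 3 → ¬ (3 : ℤ) ∣ padicValRat ℓ W₀.Δ)
    (h3Δ : 3 ∣ M → ¬ (3 : ℤ) ∣ padicValRat 3 W₀.Δ)
    (ι : PadicAlgCl 3 ≃+* ℂ)
    (hαβ : ∀ g : CuspForm (Gamma0 M) 2, IsNewform0 g → Valued.v (ι.symm (cuspCoeff g q - (q + 1))) < 1 →
      ∀ β : ℂ, β ^ 2 - cuspCoeff g q * β + q = 0 → Valued.v (ι.symm (β - q)) < 1 → cuspCoeff g q - β ≠ β) :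
    ∃ d : ℕ, kuriharaPartialDeepInfty W₀ 3 D₀.f = d ∧
      kuriharaPartial W₀ 3 D₀.f 0 ≤
        ((padicValNat 3 (Nat.card (AddCommGroup.primaryComponent W₀.sha 3)) + d : ℕ) : ℕ∞) := by
  have hsurj : W₀.HasSurjectiveModNGaloisRep ((3 : ℕ) : ℤ) := by simpa only [pow_one] using htower 1
  obtain ⟨r, hr, -, hrn, -, hr1, hE⟩ := exists_prime_one_mod_not_dvd_frobeniusTrace_sub W₀ hsurj (M * q)
  exact stub_nonAdditive_semistable_of_ribet_of_ne hR hV hGV hI hSk hmod hGZK hM hBCDT hLL' W₀ htower hfin hN D₀ hopt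
    hdeg hint hord hnA hsst hordinary hv hsplit hq3 hqM hMsq hqΔ hℓΔ h3Δ ι hαβ hr hrn hr1 hE

/-- ★★ **`stub_nonAdditive` (crux 19679 `DeepLowerAtThreeOffKatoStratum`) on its SEMISTABLE depth-`1` rows with
Tamagawa-`3` prime `q ≢ 1 (mod 3)`, from TEN NAMED FACTS and the ROW CONDITIONS ONLY.** Binders: the ten facts;
the registered stub's binders VERBATIM (level `M·q`); `Semistable W₀`; «ordinary if good at `3`»; `v₃(∏ c_ℓ) ≤ 1`;
`q` split multiplicative, `q ≠ 3`, `q ∤ M`, `M` squarefree, `3 ∣ ord_q Δ`, `3 ∤ ord_ℓ Δ` (`ℓ ∣ M` prime, `ℓ ≠ 3`),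
`3 ∣ M → 3 ∤ ord_3 Δ`, `q % 3 ≠ 1`. Nothing else is displayed. [cite: Ribet1990, Thm. 1.1]
[cite: Diamond1995RefinedSerre, Thm. 6.4 and Cor. 6.5] [cite: Vatsal1999, §1 (1.6), Thm. (1.13)]
[cite: GreenbergVatsal2000, §3 (17)–(19)] [cite: Ribet1984ICM, Thm. 4.1] [cite: TateGCFT1967, §2.4 (Tchebotarev density theorem) with Prop. 2.3]
[cite: Skinner2016PacificMC, Thm. C (§1)] [cite: Mazur1978, Cor. 4.1] [cite: Kim2022StructureSelmer, Conj. 1.10 (PDF p. 8)] -/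
theorem stub_nonAdditive_semistable_depthOne_of_mod_three_ne_one
    (hR : ribet1990_levelLowering_gamma0_newform_at_three)
    (hV : vatsal1999_plusSymbol_congruence) (hGV : greenbergVatsal2000_plusSymbol_congruence)
    (hI : ribet1984_iharaLemma)
    (hSk : Skinner2016.thmC_padicValRat_bsd_rank_zero)
    (hmod : hasEntireLFunction_rat) (hGZK : rank_eq_analyticRank_of_analyticRank_le_one)
    (hM : mazur_not_dvd_maninConstant_of_odd)
    (hBCDT : exists_isNewformOf) (hLL' : diamond1995_refinedSerre) :
    ∀ (W₀ : WeierstrassCurve ℚ) [W₀.IsElliptic] [W₀.IsGloballyMinimal],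
      (∀ n : ℕ, W₀.HasSurjectiveModNGaloisRep (3 ^ n : ℕ)) → Finite W₀.sha →
      ∀ {M q : ℕ} [NeZero M] [NeZero q] [Fact q.Prime] [NeZero (M * q)], M * q = W₀.conductorNorm ℤ →
      ∀ (D₀ : ModularParametrizationData W₀ (M * q)),
        (∀ z ∈ D₀.L.lattice, ∃ w ∈ periodLattice D₀.f, z = D₀.c * w) →
        (∀ (W₂ : WeierstrassCurve ℚ) [W₂.IsElliptic] (D₂ : ModularParametrizationData W₂ (M * q)),
          D₂.f = D₀.f → D₀.modularDegree ≤ D₂.modularDegree) →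
        (∀ r : ℚ, ratPlusSymbol D₀.f r ≠ 0 → 0 ≤ padicValRat 3 (ratPlusSymbol D₀.f r)) →
        kuriharaVanishingOrder W₀ 3 D₀.f = 0 →
        ¬ (haveI : Fact (Nat.Prime 3) := ⟨Nat.prime_three⟩; Addv W₀ 3) →
        Semistable W₀ →
        (W₀.HasGoodReductionAtPrime 3 → ¬ (3 : ℤ) ∣ W₀.frobeniusTrace 3) →
        padicValNat 3 W₀.tamagawaProduct ≤ 1 →
        W₀.HasSplitMultiplicativeReductionAtPrime q →
        q ≠ 3 → ¬ q ∣ M → Squarefree M → (3 : ℤ) ∣ padicValRat q W₀.Δ →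
        (∀ ℓ : ℕ, ℓ.Prime → ℓ ∣ M → ℓ ≠ 3 → ¬ (3 : ℤ) ∣ padicValRat ℓ W₀.Δ) →
        (3 ∣ M → ¬ (3 : ℤ) ∣ padicValRat 3 W₀.Δ) →
        q % 3 ≠ 1 →
        ∃ d : ℕ, kuriharaPartialDeepInfty W₀ 3 D₀.f = d ∧
          kuriharaPartial W₀ 3 D₀.f 0 ≤
            ((padicValNat 3 (Nat.card (AddCommGroup.primaryComponent W₀.sha 3)) + d : ℕ) : ℕ∞) := by
  intro W₀ _ _ htower hfin M q _ _ _ _ hN D₀ hopt hdeg hint hord hnA hsst hordinary hv hsplit hq3 hqM hMsq hqΔ hℓΔ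
    h3Δ hq31
  set ι : PadicAlgCl 3 ≃+* ℂ := Classical.choice (PadicAlgCl.nonempty_ringEquiv_complex 3) with hι
  exact stub_nonAdditive_semistable_depthOne_of_ne hR hV hGV hI hSk hmod hGZK hM hBCDT hLL' W₀ htower hfin hN D₀ hopt
    hdeg hint hord hnA hsst hordinary hv hsplit hq3 hqM hMsq hqΔ hℓΔ h3Δ ι
    (fun g _ haq β _ hβq ↦ sub_ne_of_mod_three_ne_one ι hq31 haq hβq)

end Summit.BirchSwinnertonDyer.BirchSwinnertonDyer.Theorems.KimAtThreeDeepLowerOffStratumLevelLoweringRibetRowsFinal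

end
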